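import Literature.AlgebraicGeometry.Frobenioids.DivisorMonoidCategoryTheoreticityFacts
import Literature.AlgebraicGeometry.Frobenioids.Thm42OfPreStepsGeneral
import Literature.AlgebraicGeometry.Frobenioids.EquivalencePreStepsFSMFF2008Assembly
import HarnessLib

/-!
# Frobenioids I, §4: the named fact `FrdI.Thm42i` — [FrdI] Theorem 4.2 (i) — HOLDS (2008 wording, no
# revision of "FSMFF-type", Frobenioids not assumed of perfect type)

Mochizuki, *The geometry of Frobenioids I: the general theory*, Kyushu J. Math. **62** (2008) 293–400,
§4, Theorem 4.2 (i), kurims p. 77: "`Ψ` preserves primary steps, Div-identity endomorphisms,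
Div-Frobenius-trivial objects and universally Div-Frobenius-trivial objects" — for `Φ_i` perf-factorial,
`C_i` of standard and isotropic type, not of group-like type, `Ψ : C₁ ⥲ C₂` an equivalence; proof pp. 78–81
[cite: MochizukiFrdI2008, Thm. 4.2 (i) p.77]; Thm. 3.4 (ii) p. 62 (pre-steps) [cite: MochizukiFrdI2008, Thm. 3.4 (ii) p.62].

PROOF-ONLY companion of `DivisorMonoidCategoryTheoreticityFacts.lean` (seat abc-iut-L1-t2: the 0-ary named
fact `FrdI.Thm42i`, FACT-LIST row F-0716, DAG node `FrdI:Thm4.2(i)`); cell abc-iut, seat abc-iut-f-037. No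
definitions; the fact is imported, never restated. The closing theorem states its FULLY-QUALIFIED type.

Assembly (two landed inputs, consumed BY NAME):
* `FrdI.T42.thm42i_ofFunctor_of_preservesPreSteps` (`Thm42OfPreStepsGeneral.lean`, seat abc-iut-w4-d105):
  the typed `(ofFunctor Φ₁ F₁).Thm42i (ofFunctor Φ₂ F₂) Ψ` for Frobenioids with `Φ_i` perf-factorial, NOT
  assumed of perfect type, MODULO ONLY "`Ψ`, `Ψ⁻¹` preserve pre-steps" — print's own route: Thm. 3.4 (iii)
  at the `C`-level from pre-step preservation, then "passing to the perfections" (p. 78 ll. 40–46);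
* `FrdI.isPreStep_map_of_isOfFSMFFType` (`EquivalencePreStepsFSMFF2008Assembly.lean`, seat abc-iut-L1-t11,
  over the isotropic core `EquivalencePreStepsFSMFF2008.lean` of seat abc-iut-L1-t13): [FrdI] Thm. 3.4 (ii),
  pre-steps, for Frobenioids of ISOTROPIC type with `D₂` of FSMFF-type in the PRINTED (2008) sense.
The antecedent `Thm42Setting` of the typed statement supplies exactly these inputs: `C_i` of isotropic type
(`Thm42Setting.isotropic`) and `D_i` of FSMFF-type (2008) through standard type (d)
(`IsOfStandardType.fsmff`). Hence `FrdI.Thm42i` holds outright — for every pair of Frobenioids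
`C_i → F_{Φ_i}` with `Φ_i` perf-factorial and every equivalence `Ψ`, with no hypothesis on the bases beyond
print's and no perfect-type assumption. Nothing of the paper is restated or strengthened; nothing here
bears on [IUTchIII] Cor. 3.12.
-/

namespace Literature.AlgebraicGeometry.Frobenioids

open CategoryTheory Opposite

universe w v v' u u'

namespace FrdI

/-- **[FrdI] Theorem 4.2 (i) AS TYPED, at `ofFunctor`, for EVERY pair of Frobenioids `C_i → F_{Φ_i}` with
`Φ_i` perf-factorial and every equivalence `Ψ`** — the typed statement's own antecedent `Thm42Setting`
(standard, isotropic, not group-like) is consumed and nothing else is assumed: pre-steps are preserved by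
`Ψ` and `Ψ⁻¹` over the 2008 FSMFF bases of standard type (d) at isotropic type
(`FrdI.isPreStep_map_of_isOfFSMFFType`), and `FrdI.T42.thm42i_ofFunctor_of_preservesPreSteps` does the rest.
[cite: MochizukiFrdI2008, Thm. 4.2 (i) p.77] -/
theorem thm42i_ofFunctor {D₁ : Type u} [Category.{v} D₁] {Φ₁ : D₁ᵒᵖ ⥤ CommMonCat.{w}} {C₁ : Type u'}
    [Category.{v'} C₁] {D₂ : Type u} [Category.{v} D₂] {Φ₂ : D₂ᵒᵖ ⥤ CommMonCat.{w}} {C₂ : Type u'}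
    [Category.{v'} C₂] {F₁ : C₁ ⥤ ElemFrobenioid Φ₁} {F₂ : C₂ ⥤ ElemFrobenioid Φ₂}
    (hF₁ : PreFrobenioid.IsFrobenioid F₁) (hF₂ : PreFrobenioid.IsFrobenioid F₂)
    (hpf₁ : ∀ X : D₁, IsPerfFactorial (Φ₁.obj (op X))) (hpf₂ : ∀ X : D₂, IsPerfFactorial (Φ₂.obj (op X)))
    (Ψ : C₁ ≌ C₂) :
    (PreFrobenioidData.ofFunctor Φ₁ F₁).Thm42i (PreFrobenioidData.ofFunctor Φ₂ F₂) Ψ := fun hT =>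
  have hist₁ : PreFrobenioid.IsOfIsotropicType F₁ :=
    (PreFrobenioidData.ofFunctor_isOfIsotropicType F₁).mp hT.isotropic.1
  have hist₂ : PreFrobenioid.IsOfIsotropicType F₂ :=
    (PreFrobenioidData.ofFunctor_isOfIsotropicType F₂).mp hT.isotropic.2
  FrdI.T42.thm42i_ofFunctor_of_preservesPreSteps Ψ hF₁ hF₂ hpf₁ hpf₂
    (fun _ _ _ hφ => isPreStep_map_of_isOfFSMFFType hF₁ hF₂ hist₁ hist₂ hT.standard.2.fsmff Ψ hφ)
    (fun _ _ _ hφ => isPreStep_map_of_isOfFSMFFType hF₂ hF₁ hist₂ hist₁ hT.standard.1.fsmff Ψ.symm hφ) hT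

/-- **The named fact [FrdI] Theorem 4.2 (i) (`FrdI.Thm42i`, FACT-LIST row F-0716) HOLDS** — 2008 wording
("FSMFF-type" as printed inside standard type (d)), Frobenioids not assumed of perfect type, `Φ_i`
perf-factorial = objectwise `IsPerfFactorial`. FULLY-QUALIFIED type. [cite: MochizukiFrdI2008, Thm. 4.2 (i) p.77] -/
theorem Thm42i_holds : Literature.AlgebraicGeometry.Frobenioids.FrdI.Thm42i.{w, v, v', u, u'} :=
  fun _ _ hF₁ hF₂ hpf₁ hpf₂ Ψ => thm42i_ofFunctor hF₁ hF₂ hpf₁ hpf₂ Ψ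

end FrdI

end Literature.AlgebraicGeometry.Frobenioids
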